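import Summits.AtomisticToContinuum.FouriersLaw.Theorems.JunctionLocalityNonBallisticStubOpenChainGreenKuboAux1
import Summits.AtomisticToContinuum.FouriersLaw.Theorems.JunctionLocalityNonBallisticStubOpenChainGreenKuboAux2

/-!
# Stub `stub_openChainGreenKubo` (GK) of line `contact-current-forgetting` — status and conditional assembly

STATUS (worker GK, 2026-08-16).  The registered stub `stub_openChainGreenKubo` of crux `JunctionLocality.NonBallistic`
(stmt-AtomisticToContinuum-9127) — verbatim the route item `HonestZwanzig.OpenChainGreenKubo` (stmt-12696) — is NOT
proved here: its response clause contains the analytic core of finite-`N` linear response for the hypoelliptic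
Langevin chain (items stmt-0717 `FiniteResponseOfUnique` / stmt-9144 `ResponseDensity`), present in the tree only as
the Literature DEFINITION `OscillatorChain.KuboFormula` (BLR 2000 (32), unproved).  What IS proved (sorry-free, landed):

* Aux1 (`…StubOpenChainGreenKuboAux1`, p86028): `pinnedChain_integrableOn_totalCorr` — the FIRST clause over tree
  vocabulary (the equilibrium total-current autocorrelation is integrable on `(0,∞)`; exponential mixing of the centred
  total current at fixed `N`, no uniqueness needed); restated below in the route vocabulary as `integrableOn_totalCorr`.
* Aux2 (`…StubOpenChainGreenKuboAux2`, p86604): `tendsto_response_greenKubo_of_kuboFormula_of_flat` — the SECOND clause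
  at fixed `(N, T)` from `KuboFormula` for the family with the constructed semigroup `pinnedChainSemigroup` + column
  flatness of the integrated Green–Kubo matrix (CF) + Onsager symmetry (MP (i), from kernel detailed balance DB).
* here: `stub_openChainGreenKubo_of_kuboFormula` — the stub's statement VERBATIM, from three named hypotheses: the
  `KuboIdentity`-shaped Kubo formula along steady families under uniqueness (the shape of the hypothesis of
  `FiniteResponse.finiteResponseOfUnique_of_kuboFormula`), the conclusion shape of CF, and the symmetry clause of MP.

Missing input, exactly: `OscillatorChain.KuboFormula N T (μ N) (pinnedChainSemigroup …)` for `N ≥ 2` under uniqueness.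
-/

noncomputable section

open MeasureTheory Set Filter Topology
open scoped NNReal BigOperators

namespace Summit.AtomisticToContinuum.FouriersLaw.Theorems.NonBallistic

open Literature.MathematicalPhysics.KineticTheory.HeatConduction
open Summit.AtomisticToContinuum.FouriersLaw.Theorems.JunctionLocality

/-- **First clause of GK in the route vocabulary**: for the pinned chain with both baths at `T > 0` (`ω₂ > 0`,
`lam ≥ 0`, `β, γ > 0`, `N ≥ 1`) the total-current autocorrelation `totalCorr P N T = corr(J,J)` is integrable on
`(0, ∞)` (`pinnedChain_integrableOn_totalCorr`, by unfolding `totalCorr`/`totalCurrentObs`/`evolve`). [folklore] -/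
theorem integrableOn_totalCorr :
    ∀ (ω₂ lam β γ : ℝ), 0 < ω₂ → 0 ≤ lam → 0 < β → 0 < γ → ∀ (T : ℝ), 0 < T → ∀ (N : ℕ), 0 < N →
      IntegrableOn (totalCorr (pinnedChain ω₂ lam β γ) N T) (Ioi 0) := by
  intro ω₂ lam β γ hω hl hβ hγ T hT N hN
  have h := pinnedChain_integrableOn_totalCorr ω₂ lam β γ hω hl hβ hγ N hN T hT
  unfold totalCorr totalCurrentObs evolve
  exact h

/-- **GK from the Kubo formula along the family, column flatness and Onsager symmetry.**  The registered stub
`stub_openChainGreenKubo` (= `HonestZwanzig.OpenChainGreenKubo`, stmt-12696) VERBATIM, from: (K) the finite-volume Kubo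
formula `OscillatorChain.KuboFormula` for every steady family under weak-NESS uniqueness, with the constructed equilibrium
semigroup `pinnedChainSemigroup` (the shape of the hypothesis of `FiniteResponse.finiteResponseOfUnique_of_kuboFormula`;
the open analytic core, items stmt-0717 / 9144); (CF) the pointwise expansion `corr(J,J) = Σ_{b,b'<N−1} M_N(b,b')` on
`t ≥ 0` with integrable entries and constant rows of the integrated Green–Kubo matrix; (S) Onsager symmetry
`M_N(b,b')(t) = M_N(b',b)(t)` for `t ≥ 0`.  The first clause is unconditional (`integrableOn_totalCorr`), the second is
`tendsto_response_greenKubo_of_kuboFormula_of_flat`. [folklore] -/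
theorem stub_openChainGreenKubo_of_kuboFormula
    (hKubo : ∀ ω₂ lam β γ : ℝ, ∀ (hω : 0 < ω₂) (hl : 0 < lam) (hβ : 0 < β) (hγ : 0 < γ),
      (∀ (N : ℕ) (T_L T_R : ℝ), 0 < T_L → 0 < T_R → ∀ μ ν : Measure (PhaseSpace N),
        (pinnedChain ω₂ lam β γ).IsSteadyState N T_L T_R μ →
          (pinnedChain ω₂ lam β γ).IsSteadyState N T_L T_R ν → μ = ν) →
      ∀ μ : (N : ℕ) → ℝ → ℝ → Measure (PhaseSpace N),
        (∀ (N : ℕ) (T_L T_R : ℝ), 0 < T_L → 0 < T_R →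
          (pinnedChain ω₂ lam β γ).IsSteadyState N T_L T_R (μ N T_L T_R)) →
        ∀ T : ℝ, ∀ (hT : 0 < T), ∀ N : ℕ, ∀ (hN : 0 < N),
          (pinnedChain ω₂ lam β γ).KuboFormula N T (μ N)
            (pinnedChainSemigroup hω hl.le hβ.le hγ.le hN hT.le hT.le))
    (hCF : ∀ ω₂ lam β γ : ℝ, 0 < ω₂ → 0 < lam → 0 < β → 0 < γ → ∀ T : ℝ, 0 < T → ∀ N : ℕ, 2 ≤ N →
      (∀ t : ℝ, 0 ≤ t → totalCorr (pinnedChain ω₂ lam β γ) N T t =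
        ∑ b ∈ Finset.range (N - 1), ∑ b' ∈ Finset.range (N - 1), gkEntry (pinnedChain ω₂ lam β γ) N T b b' t) ∧
      ∀ b b' : ℕ, b + 1 < N → b' + 1 < N →
        IntegrableOn (gkEntry (pinnedChain ω₂ lam β γ) N T b b') (Ioi 0) ∧
        ∫ t in Ioi (0 : ℝ), gkEntry (pinnedChain ω₂ lam β γ) N T b b' t =
          ∫ t in Ioi (0 : ℝ), gkEntry (pinnedChain ω₂ lam β γ) N T b 0 t)
    (hSym : ∀ ω₂ lam β γ : ℝ, 0 < ω₂ → 0 < lam → 0 < β → 0 < γ → ∀ T : ℝ, 0 < T → ∀ N : ℕ, 2 ≤ N →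
      ∀ b b' : ℕ, ∀ t : ℝ, 0 ≤ t →
        gkEntry (pinnedChain ω₂ lam β γ) N T b b' t = gkEntry (pinnedChain ω₂ lam β γ) N T b' b t) :
    ∀ ω₂ lam β γ : ℝ, 0 < ω₂ → 0 < lam → 0 < β → 0 < γ →
    (∀ (N : ℕ) (T_L T_R : ℝ), 0 < T_L → 0 < T_R → ∀ μ ν : Measure (PhaseSpace N),
      (pinnedChain ω₂ lam β γ).IsSteadyState N T_L T_R μ →
      (pinnedChain ω₂ lam β γ).IsSteadyState N T_L T_R ν → μ = ν) →
    ∀ μf : (N : ℕ) → ℝ → ℝ → Measure (PhaseSpace N),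
      (∀ (N : ℕ) (T_L T_R : ℝ), 0 < T_L → 0 < T_R →
        (pinnedChain ω₂ lam β γ).IsSteadyState N T_L T_R (μf N T_L T_R)) →
    ∀ T : ℝ, 0 < T → ∀ N : ℕ, 2 ≤ N →
      IntegrableOn (totalCorr (pinnedChain ω₂ lam β γ) N T) (Ioi 0) ∧
      Tendsto (fun δ : ℝ => (pinnedChain ω₂ lam β γ).totalCurrent (μf N (T + δ / 2) (T - δ / 2)) / δ)
        (nhdsWithin 0 {(0 : ℝ)}ᶜ)
        (nhds ((∫ t in Ioi (0 : ℝ), totalCorr (pinnedChain ω₂ lam β γ) N T t) / (((N : ℝ) - 1) * T ^ 2))) := by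
  intro ω₂ lam β γ hω hl hβ hγ huniq μf hμf T hT N hN
  have hN0 : 0 < N := by omega
  refine ⟨integrableOn_totalCorr ω₂ lam β γ hω hl.le hβ hγ T hT N hN0, ?_⟩
  obtain ⟨hsum, hflat⟩ := hCF ω₂ lam β γ hω hl hβ hγ T hT N hN
  exact tendsto_response_greenKubo_of_kuboFormula_of_flat ω₂ lam β γ hω hl hβ hγ T hT N hN0 hN
    (huniq N T T hT hT) (μf N) (hμf N T T hT hT) (hKubo ω₂ lam β γ hω hl hβ hγ huniq μf hμf T hT N hN0)
    hsum hflat (hSym ω₂ lam β γ hω hl hβ hγ T hT N hN)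

end Summit.AtomisticToContinuum.FouriersLaw.Theorems.NonBallistic

end
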